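import Summits.ValiantsHypothesis.ValiantsHypothesis.Theorems.LacunarySymmetroidMatrixDescartesMomentLaw

/-!
# `MatrixDescartes` (stmt-ValiantsHypothesis-18050) — the negative-moment law on the CLOSED sector:
# a negative-SEMIdefinite scale already caps the count (`Z₊ ≤ 2·n + 1`)

HONEST FRAMING.  Cell `pub-symmetroid`, seat `val-sym-mdr-p2` (gen 10); helper `--supports` the crux
`Theses.LacunarySymmetroid.MatrixDescartes`, NO closure claim.  Companion of `…MomentLaw.lean` (p553044:
`F(x₀) ≺ 0 ⇒ Z₊ ≤ 2·card ι`).  Nothing here bears on the crux in its window, `stub_twoSided`, `DoorA26`/`DoorA34`, the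
cell's registers, or `VP ≠ VNP`.

**THEOREM (`semidefMoment_posRoots_le`).**  `F(X) = X^e J + ∑ k, X^{d k} P k`, `J` real symmetric, every `P k ⪰ 0`
(any finite letter type, any exponents).  If at one scale `x₀ > 0` the real matrix `F(x₀)` is negative SEMIdefinite
(`vᵀF(x₀)v ≤ 0` for all `v`), then `det F` has at most `card ι` distinct zeros in `(0, x₀)` and at most `card ι` in
`(x₀, ∞)` (`semidefMoment_posRoots_below_le`, `semidefMoment_posRoots_above_le`); `x₀` itself may be a zero, so
`Z₊ ≤ 2·card ι + 1`.  The sector {pencils with a non-positive scale} is the CLOSURE of the negative-moment sector; the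
law survives on it with the same mechanism.

PROOF.  With `H(x) = x^{-e}F(x)` and `φ_v(x) = vᵀH(x)v` (convex on `(0,∞)`, `…MomentLaw`), a semidefinite moment
gives only WEAK propagation (`x₀ < y < z`, `φ_v(y) ≥ 0 ⇒ φ_v(z) ≥ 0`).  Strictness can fail only if `φ_v` vanishes
at three points `x₀, y, z`; then (i) every letter with `d k − e ∉ {0, 1}` kills `v` — its weight `x^{d k−e}` is
STRICTLY convex (Mathlib `strictConvexOn_zpow`), so a positive `vᵀP_k v` would make the secant inequality strict
(`MomentLawSemidef.secant_form_strict`); (ii) the letters at `e+1` kill `v` (their weight `x` separates two zeros);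
(iii) hence `H(x)v` is independent of `x`, and `vᵀH(x₀)v = 0` with `H(x₀) ⪯ 0` forces `H(x₀)v = 0`: `v` is a
constant kernel vector, `det F` vanishes on `(0,∞)`, so `det F = 0` has no counted roots
(`MomentLawSemidef.det_eq_zero_of_degenerate`).  Otherwise propagation is strict and the directed kernel chain of
`…MomentLaw` (`MomentLaw.card_le_of_directed`) applies on each side of `x₀`.  Elementary given p553044 and Mathlib;
axioms `propext`, `Classical.choice`, `Quot.sound`.
-/

-- layout Summits/ValiantsHypothesis/ValiantsHypothesis forces the duplicated namespace component
set_option linter.dupNamespace false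

namespace Summit.ValiantsHypothesis.ValiantsHypothesis.Theorems.LacunarySymmetroidMatrixDescartes

open Polynomial Matrix Finset
open scoped BigOperators
open MomentLaw

namespace MomentLawSemidef

variable {ι κ : Type} [Fintype ι] [Fintype κ]

/-- Strict three-point secant inequality for `x ↦ x^d/x^e` when `d − e ∉ {0, 1}` (strict convexity of `zpow`,
Mathlib `strictConvexOn_zpow`). [folklore] -/
theorem secant_powDiv_strict (d e : ℕ) (hd0 : d ≠ e) (hd1 : d ≠ e + 1) {x y z : ℝ} (hx : 0 < x) (hxy : x < y)
    (hyz : y < z) :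
    (z - x) * (y ^ d / y ^ e) < (z - y) * (x ^ d / x ^ e) + (y - x) * (z ^ d / z ^ e) := by
  have hm0 : ((d : ℤ) - (e : ℤ)) ≠ 0 := fun h => hd0 (by omega)
  have hm1 : ((d : ℤ) - (e : ℤ)) ≠ 1 := fun h => hd1 (by omega)
  have hconv := strictConvexOn_zpow hm0 hm1
  have hy : 0 < y := hx.trans hxy
  have hz : 0 < z := hy.trans hyz
  have key := hconv.secant_strict_mono_aux1 (x := x) (y := y) (z := z) hx hz hxy hyz
  have hrew : ∀ t : ℝ, 0 < t → t ^ ((d : ℤ) - e) = t ^ d / t ^ e := fun t ht => by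
    rw [zpow_sub₀ ht.ne', zpow_natCast, zpow_natCast]
  simp only [hrew x hx, hrew y hy, hrew z hz] at key
  exact key

/-- **Strict secant for a Rayleigh form that sees a strictly convex letter**: if some letter `k` with
`d k ∉ {e, e+1}` has `vᵀP_k v > 0`, then `(z−x)φ_v(y) < (z−y)φ_v(x) + (y−x)φ_v(z)` for `0 < x < y < z`. [folklore] -/
theorem secant_form_strict (e : ℕ) (d : κ → ℕ) (J : Matrix ι ι ℝ) {P : κ → Matrix ι ι ℝ}
    (hP : ∀ k, (P k).PosSemidef) (v : ι → ℝ) {k₀ : κ} (hk0 : d k₀ ≠ e) (hk1 : d k₀ ≠ e + 1)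
    (hq : 0 < v ⬝ᵥ (P k₀ *ᵥ v)) {x y z : ℝ} (hx : 0 < x) (hxy : x < y) (hyz : y < z) :
    (z - x) * (v ⬝ᵥ ((J + ∑ k, (y ^ d k / y ^ e) • P k) *ᵥ v))
      < (z - y) * (v ⬝ᵥ ((J + ∑ k, (x ^ d k / x ^ e) • P k) *ᵥ v))
        + (y - x) * (v ⬝ᵥ ((J + ∑ k, (z ^ d k / z ^ e) • P k) *ᵥ v)) := by
  classical
  have hqnn : ∀ k, 0 ≤ v ⬝ᵥ (P k *ᵥ v) := fun k => by
    simpa only [star_trivial] using (hP k).dotProduct_mulVec_nonneg v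
  simp only [form_hform]
  -- termwise: weak inequality for every letter, strict for `k₀`
  have hweak : ∀ k, (z - x) * ((y ^ d k / y ^ e) * (v ⬝ᵥ (P k *ᵥ v)))
      ≤ (z - y) * ((x ^ d k / x ^ e) * (v ⬝ᵥ (P k *ᵥ v)))
        + (y - x) * ((z ^ d k / z ^ e) * (v ⬝ᵥ (P k *ᵥ v))) := by
    intro k
    have h := mul_le_mul_of_nonneg_right (secant_powDiv (d k) e hx hxy hyz) (hqnn k)
    nlinarith [h]
  have hstrict : (z - x) * ((y ^ d k₀ / y ^ e) * (v ⬝ᵥ (P k₀ *ᵥ v)))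
      < (z - y) * ((x ^ d k₀ / x ^ e) * (v ⬝ᵥ (P k₀ *ᵥ v)))
        + (y - x) * ((z ^ d k₀ / z ^ e) * (v ⬝ᵥ (P k₀ *ᵥ v))) := by
    have h := mul_lt_mul_of_pos_right (secant_powDiv_strict (d k₀) e hk0 hk1 hx hxy hyz) hq
    nlinarith [h]
  have hsum : ∑ k, (z - x) * ((y ^ d k / y ^ e) * (v ⬝ᵥ (P k *ᵥ v)))
      < ∑ k, ((z - y) * ((x ^ d k / x ^ e) * (v ⬝ᵥ (P k *ᵥ v)))
        + (y - x) * ((z ^ d k / z ^ e) * (v ⬝ᵥ (P k *ᵥ v)))) :=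
    Finset.sum_lt_sum (fun k _ => hweak k) ⟨k₀, Finset.mem_univ _, hstrict⟩
  rw [Finset.sum_add_distrib] at hsum
  have e1 : (z - x) * (v ⬝ᵥ (J *ᵥ v)) = (z - y) * (v ⬝ᵥ (J *ᵥ v)) + (y - x) * (v ⬝ᵥ (J *ᵥ v)) := by ring
  rw [mul_add, mul_add, mul_add, Finset.mul_sum, Finset.mul_sum, Finset.mul_sum, e1]
  linarith [hsum]

/-- **Three zeros kill the non-pivot letters.**  If `φ_v` vanishes at `0 < x₁ < x₂ < x₃` then `P_k v = 0` for every
letter with `d k ≠ e` (strict convexity for `d k − e ∉ {0,1}`, then the linear weight at `e+1`). [folklore] -/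
theorem letters_kill_of_three_zeros (e : ℕ) (d : κ → ℕ) (J : Matrix ι ι ℝ) {P : κ → Matrix ι ι ℝ}
    (hP : ∀ k, (P k).PosSemidef) (v : ι → ℝ) {x₁ x₂ x₃ : ℝ} (hx₁ : 0 < x₁) (h12 : x₁ < x₂) (h23 : x₂ < x₃)
    (hz₁ : v ⬝ᵥ ((J + ∑ k, (x₁ ^ d k / x₁ ^ e) • P k) *ᵥ v) = 0)
    (hz₂ : v ⬝ᵥ ((J + ∑ k, (x₂ ^ d k / x₂ ^ e) • P k) *ᵥ v) = 0)
    (hz₃ : v ⬝ᵥ ((J + ∑ k, (x₃ ^ d k / x₃ ^ e) • P k) *ᵥ v) = 0) :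
    ∀ k, d k ≠ e → P k *ᵥ v = 0 := by
  classical
  have hqnn : ∀ k, 0 ≤ v ⬝ᵥ (P k *ᵥ v) := fun k => by
    simpa only [star_trivial] using (hP k).dotProduct_mulVec_nonneg v
  have hzero_iff : ∀ k, v ⬝ᵥ (P k *ᵥ v) = 0 → P k *ᵥ v = 0 := fun k hk => by
    have h := (hP k).dotProduct_mulVec_zero_iff v
    rw [star_trivial] at h
    exact h.1 hk
  -- (i) letters with strictly convex weight
  have hconvex : ∀ k, d k ≠ e → d k ≠ e + 1 → v ⬝ᵥ (P k *ᵥ v) = 0 := by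
    intro k hk0 hk1
    by_contra hne
    have hpos : 0 < v ⬝ᵥ (P k *ᵥ v) := (hqnn k).lt_of_ne (Ne.symm hne)
    have h := secant_form_strict e d J hP v hk0 hk1 hpos hx₁ h12 h23
    rw [hz₁, hz₂, hz₃] at h
    simp at h
  -- (ii) letters at `e + 1`: the difference `φ(x₂) − φ(x₁)` is `(x₂ − x₁) · ∑_{d k = e+1} q_k`
  have hx₂ : 0 < x₂ := hx₁.trans h12
  have hdiff : ∑ k, (x₂ ^ d k / x₂ ^ e - x₁ ^ d k / x₁ ^ e) * (v ⬝ᵥ (P k *ᵥ v)) = 0 := by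
    have h := congrArg₂ (· - ·) hz₂ hz₁
    simp only [form_hform, sub_self] at h
    rw [← h, add_sub_add_left_eq_sub, ← Finset.sum_sub_distrib]
    exact Finset.sum_congr rfl fun k _ => by ring
  have hterm : ∀ k, (x₂ ^ d k / x₂ ^ e - x₁ ^ d k / x₁ ^ e) * (v ⬝ᵥ (P k *ᵥ v))
      = if d k = e + 1 then (x₂ - x₁) * (v ⬝ᵥ (P k *ᵥ v)) else 0 := by
    intro k
    by_cases h1 : d k = e + 1
    · rw [if_pos h1, h1, pow_succ, pow_succ, mul_div_cancel_left₀ _ (pow_ne_zero _ hx₂.ne'),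
        mul_div_cancel_left₀ _ (pow_ne_zero _ hx₁.ne')]
    · rw [if_neg h1]
      by_cases h0 : d k = e
      · rw [h0, div_self (pow_ne_zero _ hx₂.ne'), div_self (pow_ne_zero _ hx₁.ne'), sub_self, zero_mul]
      · rw [hconvex k h0 h1, mul_zero]
  simp only [hterm] at hdiff
  rw [Finset.sum_ite, Finset.sum_const_zero, add_zero, ← Finset.mul_sum] at hdiff
  have hsum0 : ∑ k ∈ Finset.univ.filter (fun k => d k = e + 1), v ⬝ᵥ (P k *ᵥ v) = 0 :=
    (mul_eq_zero.1 hdiff).resolve_left (sub_pos.2 h12).ne'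
  have hlin : ∀ k, d k = e + 1 → v ⬝ᵥ (P k *ᵥ v) = 0 := by
    intro k hk
    have h := (Finset.sum_eq_zero_iff_of_nonneg fun k _ => hqnn k).1 hsum0 k
      (Finset.mem_filter.2 ⟨Finset.mem_univ _, hk⟩)
    exact h
  intro k hk
  by_cases h1 : d k = e + 1
  · exact hzero_iff k (hlin k h1)
  · exact hzero_iff k (hconvex k hk h1)

/-- If every letter off the pivot exponent kills `v`, then `H(x) v` does not depend on `x`. [folklore] -/
theorem hform_mulVec_const (e : ℕ) (d : κ → ℕ) (J : Matrix ι ι ℝ) (P : κ → Matrix ι ι ℝ) (v : ι → ℝ)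
    (hkill : ∀ k, d k ≠ e → P k *ᵥ v = 0) {x x' : ℝ} (hx : x ≠ 0) (hx' : x' ≠ 0) :
    (J + ∑ k, (x ^ d k / x ^ e) • P k) *ᵥ v = (J + ∑ k, (x' ^ d k / x' ^ e) • P k) *ᵥ v := by
  rw [Matrix.add_mulVec, Matrix.add_mulVec, Matrix.sum_mulVec, Matrix.sum_mulVec]
  congr 1
  refine Finset.sum_congr rfl fun k _ => ?_
  rw [Matrix.smul_mulVec, Matrix.smul_mulVec]
  by_cases hk : d k = e
  · rw [hk, div_self (pow_ne_zero _ hx), div_self (pow_ne_zero _ hx')]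
  · rw [hkill k hk, smul_zero, smul_zero]

/-- **Degenerate vectors force `det F = 0`.**  If `H(x₀) ⪯ 0` (as forms), `φ_v` vanishes at three points
`0 < x₁ < x₂ < x₃` one of which is `x₀`, and `v ≠ 0`, then `det (X^e J + ∑ X^{d k} P k) = 0`. [folklore] -/
theorem det_eq_zero_of_degenerate [DecidableEq ι] (e : ℕ) (d : κ → ℕ) {J : Matrix ι ι ℝ}
    {P : κ → Matrix ι ι ℝ} (hJ : J.IsSymm) (hP : ∀ k, (P k).PosSemidef) {x₀ : ℝ} (hx₀ : 0 < x₀)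
    (hle : ∀ u : ι → ℝ, u ⬝ᵥ ((J + ∑ k, (x₀ ^ d k / x₀ ^ e) • P k) *ᵥ u) ≤ 0)
    {v : ι → ℝ} (hv : v ≠ 0) (hv0 : v ⬝ᵥ ((J + ∑ k, (x₀ ^ d k / x₀ ^ e) • P k) *ᵥ v) = 0)
    {x₁ x₂ x₃ : ℝ} (hx₁ : 0 < x₁) (h12 : x₁ < x₂) (h23 : x₂ < x₃)
    (hz₁ : v ⬝ᵥ ((J + ∑ k, (x₁ ^ d k / x₁ ^ e) • P k) *ᵥ v) = 0)
    (hz₂ : v ⬝ᵥ ((J + ∑ k, (x₂ ^ d k / x₂ ^ e) • P k) *ᵥ v) = 0)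
    (hz₃ : v ⬝ᵥ ((J + ∑ k, (x₃ ^ d k / x₃ ^ e) • P k) *ᵥ v) = 0) :
    Matrix.det (((Polynomial.X : Polynomial ℝ) ^ e) • J.map Polynomial.C
        + ∑ k, ((Polynomial.X : Polynomial ℝ) ^ d k) • (P k).map Polynomial.C) = 0 := by
  have hkill := letters_kill_of_three_zeros e d J hP v hx₁ h12 h23 hz₁ hz₂ hz₃
  -- `−H(x₀)` is positive semidefinite, its form vanishes at `v`, so `H(x₀) v = 0`
  have hsymm : (J + ∑ k, (x₀ ^ d k / x₀ ^ e) • P k).IsSymm := isSymm_hform e d hJ hP x₀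
  have hpsd : (-(J + ∑ k, (x₀ ^ d k / x₀ ^ e) • P k)).PosSemidef := by
    refine Matrix.PosSemidef.of_dotProduct_mulVec_nonneg ?_ fun u => ?_
    · exact Matrix.isHermitian_iff_isSymm.2 hsymm.neg
    · rw [star_trivial, Matrix.neg_mulVec, dotProduct_neg]
      exact neg_nonneg.2 (hle u)
  have hker₀ : (J + ∑ k, (x₀ ^ d k / x₀ ^ e) • P k) *ᵥ v = 0 := by
    have h := hpsd.dotProduct_mulVec_zero_iff v
    rw [star_trivial, Matrix.neg_mulVec, dotProduct_neg, neg_eq_zero, neg_eq_zero] at h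
    exact h.1 hv0
  -- hence `H(x) v = 0` for every `x > 0`, and `det F` vanishes on `(0, ∞)`
  have hker : ∀ x : ℝ, 0 < x → (J + ∑ k, (x ^ d k / x ^ e) • P k) *ᵥ v = 0 := fun x hx => by
    rw [hform_mulVec_const e d J P v hkill hx.ne' hx₀.ne', hker₀]
  refine Polynomial.eq_zero_of_infinite_isRoot _ (Set.infinite_of_forall_exists_gt fun a => ?_)
  refine ⟨max a 0 + 1, ?_, by linarith [le_max_left a 0]⟩
  have hxpos : 0 < max a 0 + 1 := by linarith [le_max_right a 0]
  have hdet : (J + ∑ k, ((max a 0 + 1) ^ d k / (max a 0 + 1) ^ e) • P k).det = 0 :=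
    Matrix.exists_mulVec_eq_zero_iff.1 ⟨v, hv, hker _ hxpos⟩
  exact (det_hform_eq_zero_iff e d J P hxpos.ne').1 hdet

/-- **Propagation above a semidefinite moment** (when `det F ≠ 0`): `x₀ < y < z`, `φ_v(y) ≥ 0 ⇒ φ_v(z) > 0`
for `v ≠ 0`. [folklore] -/
theorem propagate_above [DecidableEq ι] (e : ℕ) (d : κ → ℕ) {J : Matrix ι ι ℝ} {P : κ → Matrix ι ι ℝ}
    (hJ : J.IsSymm) (hP : ∀ k, (P k).PosSemidef) {x₀ : ℝ} (hx₀ : 0 < x₀)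
    (hle : ∀ u : ι → ℝ, u ⬝ᵥ ((J + ∑ k, (x₀ ^ d k / x₀ ^ e) • P k) *ᵥ u) ≤ 0)
    (hdet : Matrix.det (((Polynomial.X : Polynomial ℝ) ^ e) • J.map Polynomial.C
        + ∑ k, ((Polynomial.X : Polynomial ℝ) ^ d k) • (P k).map Polynomial.C) ≠ 0)
    {y z : ℝ} (hy : x₀ < y) (hz : y < z) (v : ι → ℝ) (hv : v ≠ 0)
    (hvy : 0 ≤ v ⬝ᵥ ((J + ∑ k, (y ^ d k / y ^ e) • P k) *ᵥ v)) :
    0 < v ⬝ᵥ ((J + ∑ k, (z ^ d k / z ^ e) • P k) *ᵥ v) := by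
  have hsec := secant_form e d J hP v hx₀ hy hz
  have h0 := hle v
  by_contra hzle
  push Not at hzle
  -- all three values vanish
  have hyz0 : 0 < z - y := sub_pos.2 hz
  have hxy0 : 0 < y - x₀ := sub_pos.2 hy
  have hxz0 : 0 < z - x₀ := sub_pos.2 (hy.trans hz)
  have hφy : v ⬝ᵥ ((J + ∑ k, (y ^ d k / y ^ e) • P k) *ᵥ v) = 0 := by
    nlinarith [mul_nonneg hxz0.le hvy, mul_nonpos_iff.2 (Or.inl ⟨hyz0.le, h0⟩),
      mul_nonpos_iff.2 (Or.inl ⟨hxy0.le, hzle⟩)]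
  have hφx : v ⬝ᵥ ((J + ∑ k, (x₀ ^ d k / x₀ ^ e) • P k) *ᵥ v) = 0 := by
    nlinarith [mul_nonpos_iff.2 (Or.inl ⟨hxy0.le, hzle⟩)]
  have hφz : v ⬝ᵥ ((J + ∑ k, (z ^ d k / z ^ e) • P k) *ᵥ v) = 0 := by
    nlinarith [mul_nonpos_iff.2 (Or.inl ⟨hyz0.le, h0⟩)]
  exact hdet (det_eq_zero_of_degenerate e d hJ hP hx₀ hle hv hφx hx₀ hy hz hφx hφy hφz)

/-- **Propagation below a semidefinite moment** (when `det F ≠ 0`): `0 < z < y < x₀`, `φ_v(y) ≥ 0 ⇒ φ_v(z) > 0`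
for `v ≠ 0`. [folklore] -/
theorem propagate_below [DecidableEq ι] (e : ℕ) (d : κ → ℕ) {J : Matrix ι ι ℝ} {P : κ → Matrix ι ι ℝ}
    (hJ : J.IsSymm) (hP : ∀ k, (P k).PosSemidef) {x₀ : ℝ} (hx₀ : 0 < x₀)
    (hle : ∀ u : ι → ℝ, u ⬝ᵥ ((J + ∑ k, (x₀ ^ d k / x₀ ^ e) • P k) *ᵥ u) ≤ 0)
    (hdet : Matrix.det (((Polynomial.X : Polynomial ℝ) ^ e) • J.map Polynomial.C
        + ∑ k, ((Polynomial.X : Polynomial ℝ) ^ d k) • (P k).map Polynomial.C) ≠ 0)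
    {y z : ℝ} (hz0 : 0 < z) (hz : z < y) (hy : y < x₀) (v : ι → ℝ) (hv : v ≠ 0)
    (hvy : 0 ≤ v ⬝ᵥ ((J + ∑ k, (y ^ d k / y ^ e) • P k) *ᵥ v)) :
    0 < v ⬝ᵥ ((J + ∑ k, (z ^ d k / z ^ e) • P k) *ᵥ v) := by
  have hsec := secant_form e d J hP v hz0 hz hy
  have h0 := hle v
  by_contra hzle
  push Not at hzle
  have hyz0 : 0 < y - z := sub_pos.2 hz
  have hxy0 : 0 < x₀ - y := sub_pos.2 hy
  have hxz0 : 0 < x₀ - z := sub_pos.2 (hz.trans hy)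
  have hφy : v ⬝ᵥ ((J + ∑ k, (y ^ d k / y ^ e) • P k) *ᵥ v) = 0 := by
    nlinarith [mul_nonneg hxz0.le hvy, mul_nonpos_iff.2 (Or.inl ⟨hyz0.le, h0⟩),
      mul_nonpos_iff.2 (Or.inl ⟨hxy0.le, hzle⟩)]
  have hφx : v ⬝ᵥ ((J + ∑ k, (x₀ ^ d k / x₀ ^ e) • P k) *ᵥ v) = 0 := by
    nlinarith [mul_nonpos_iff.2 (Or.inl ⟨hyz0.le, hzle⟩)]
  have hφz : v ⬝ᵥ ((J + ∑ k, (z ^ d k / z ^ e) • P k) *ᵥ v) = 0 := by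
    nlinarith [mul_nonpos_iff.2 (Or.inl ⟨hxy0.le, h0⟩)]
  exact hdet (det_eq_zero_of_degenerate e d hJ hP hx₀ hle hv hφx hz0 hz hy hφz hφy hφx)

/-- The semidefinite moment in H-form. [folklore] -/
theorem hform_le_of_le (e : ℕ) (d : κ → ℕ) (J : Matrix ι ι ℝ) (P : κ → Matrix ι ι ℝ) {x₀ : ℝ}
    (hx₀ : 0 < x₀) (hle : ∀ v : ι → ℝ, v ⬝ᵥ ((x₀ ^ e • J + ∑ k, x₀ ^ d k • P k) *ᵥ v) ≤ 0)
    (v : ι → ℝ) : v ⬝ᵥ ((J + ∑ k, (x₀ ^ d k / x₀ ^ e) • P k) *ᵥ v) ≤ 0 := by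
  have h := hle v
  rw [← smul_hform e d J P hx₀.ne', Matrix.smul_mulVec, dotProduct_smul, smul_eq_mul] at h
  exact nonpos_of_mul_nonpos_right h (pow_pos hx₀ e) |> fun h' => by
    rcases (mul_nonpos_iff.1 h) with ⟨_, h2⟩ | ⟨h1, _⟩
    · exact h2
    · exact absurd h1 (not_le.2 (pow_pos hx₀ e))

end MomentLawSemidef

open MomentLawSemidef

section Law

variable (ι κ : Type) [Fintype ι] [DecidableEq ι] [Fintype κ]

/-- **Semidefinite moment, upper half**: `F(x₀) ⪯ 0` (`x₀ > 0`) ⇒ at most `card ι` distinct zeros of `det F` in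
`(x₀, ∞)`. [folklore] -/
theorem semidefMoment_posRoots_above_le (e : ℕ) (d : κ → ℕ) (J : Matrix ι ι ℝ) (P : κ → Matrix ι ι ℝ)
    (hJ : J.IsSymm) (hP : ∀ k, (P k).PosSemidef) {x₀ : ℝ} (hx₀ : 0 < x₀)
    (hle : ∀ v : ι → ℝ, v ⬝ᵥ ((x₀ ^ e • J + ∑ k, x₀ ^ d k • P k) *ᵥ v) ≤ 0) :
    ((Matrix.det (((Polynomial.X : Polynomial ℝ) ^ e) • J.map Polynomial.C
        + ∑ k, ((Polynomial.X : Polynomial ℝ) ^ d k) • (P k).map Polynomial.C)).roots.toFinset.filter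
          (fun t => x₀ < t)).card ≤ Fintype.card ι := by
  set p := Matrix.det (((Polynomial.X : Polynomial ℝ) ^ e) • J.map Polynomial.C
        + ∑ k, ((Polynomial.X : Polynomial ℝ) ^ d k) • (P k).map Polynomial.C) with hp
  by_cases hdet : p = 0
  · simp [hdet]
  set R := p.roots.toFinset.filter (fun t => x₀ < t) with hR
  let τ : Fin R.card ↪o ℝ := R.orderEmbOfFin rfl
  have hτmem : ∀ j, τ j ∈ R := fun j => R.orderEmbOfFin_mem rfl j
  have hτgt : ∀ j, x₀ < τ j := fun j => (Finset.mem_filter.1 (hτmem j)).2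
  have hτroot : ∀ j, p.IsRoot (τ j) := fun j => by
    have h1 := (Finset.mem_filter.1 (hτmem j)).1
    rw [Multiset.mem_toFinset] at h1
    exact (Polynomial.mem_roots hdet).1 h1
  have hle' := hform_le_of_le e d J P hx₀ hle
  refine card_le_of_directed (fun x => J + ∑ k, (x ^ d k / x ^ e) • P k) (fun s t => s < t) (Set.Ioi x₀)
    (fun s _ => isSymm_hform e d hJ hP s) ?_ τ (fun j => hτgt j) (fun i j hij => τ.strictMono hij) ?_
  · intro s hs t _ hst x hx hsx
    exact propagate_above e d hJ hP hx₀ hle' hdet hs hst x hx hsx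
  · intro j
    exact (det_hform_eq_zero_iff e d J P (hx₀.trans (hτgt j)).ne').2 (hτroot j)

/-- **Semidefinite moment, lower half**: `F(x₀) ⪯ 0` ⇒ at most `card ι` distinct zeros of `det F` in `(0, x₀)`.
[folklore] -/
theorem semidefMoment_posRoots_below_le (e : ℕ) (d : κ → ℕ) (J : Matrix ι ι ℝ) (P : κ → Matrix ι ι ℝ)
    (hJ : J.IsSymm) (hP : ∀ k, (P k).PosSemidef) {x₀ : ℝ} (hx₀ : 0 < x₀)
    (hle : ∀ v : ι → ℝ, v ⬝ᵥ ((x₀ ^ e • J + ∑ k, x₀ ^ d k • P k) *ᵥ v) ≤ 0) :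
    ((Matrix.det (((Polynomial.X : Polynomial ℝ) ^ e) • J.map Polynomial.C
        + ∑ k, ((Polynomial.X : Polynomial ℝ) ^ d k) • (P k).map Polynomial.C)).roots.toFinset.filter
          (fun t => 0 < t ∧ t < x₀)).card ≤ Fintype.card ι := by
  set p := Matrix.det (((Polynomial.X : Polynomial ℝ) ^ e) • J.map Polynomial.C
        + ∑ k, ((Polynomial.X : Polynomial ℝ) ^ d k) • (P k).map Polynomial.C) with hp
  by_cases hdet : p = 0
  · simp [hdet]
  set R := p.roots.toFinset.filter (fun t => 0 < t ∧ t < x₀) with hR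
  let σ : Fin R.card ↪o ℝ := R.orderEmbOfFin rfl
  let τ : Fin R.card → ℝ := fun j => σ (Fin.rev j)
  have hτmem : ∀ j, τ j ∈ R := fun j => R.orderEmbOfFin_mem rfl (Fin.rev j)
  have hτpos : ∀ j, 0 < τ j := fun j => (Finset.mem_filter.1 (hτmem j)).2.1
  have hτlt : ∀ j, τ j < x₀ := fun j => (Finset.mem_filter.1 (hτmem j)).2.2
  have hτroot : ∀ j, p.IsRoot (τ j) := fun j => by
    have h1 := (Finset.mem_filter.1 (hτmem j)).1
    rw [Multiset.mem_toFinset] at h1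
    exact (Polynomial.mem_roots hdet).1 h1
  have hτanti : ∀ i j : Fin R.card, i < j → τ j < τ i := fun i j hij =>
    σ.strictMono (Fin.rev_lt_rev.2 hij)
  have hle' := hform_le_of_le e d J P hx₀ hle
  refine card_le_of_directed (fun x => J + ∑ k, (x ^ d k / x ^ e) • P k) (fun s t => t < s)
    (Set.Ioo 0 x₀) (fun s _ => isSymm_hform e d hJ hP s) ?_ τ (fun j => ⟨hτpos j, hτlt j⟩) hτanti ?_
  · intro s hs t ht hts x hx hsx
    exact propagate_below e d hJ hP hx₀ hle' hdet ht.1 hts hs.2 x hx hsx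
  · intro j
    exact (det_hform_eq_zero_iff e d J P (hτpos j).ne').2 (hτroot j)

/-- **THE NEGATIVE-MOMENT LAW ON THE CLOSED SECTOR.**  `F(X) = X^e J + ∑ k, X^{d k} P k`, `J` real symmetric, every
`P k ⪰ 0`; if `F(x₀)` is negative SEMIdefinite at one scale `x₀ > 0` (`vᵀF(x₀)v ≤ 0` for all `v`), then `det F` has at
most `2·card ι + 1` distinct positive zeros (`card ι` on each side of `x₀`, possibly `x₀`). [folklore] -/
theorem semidefMoment_posRoots_le (e : ℕ) (d : κ → ℕ) (J : Matrix ι ι ℝ) (P : κ → Matrix ι ι ℝ)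
    (hJ : J.IsSymm) (hP : ∀ k, (P k).PosSemidef) (x₀ : ℝ) (hx₀ : 0 < x₀)
    (hle : ∀ v : ι → ℝ, v ⬝ᵥ ((x₀ ^ e • J + ∑ k, x₀ ^ d k • P k) *ᵥ v) ≤ 0) :
    ((Matrix.det (((Polynomial.X : Polynomial ℝ) ^ e) • J.map Polynomial.C
        + ∑ k, ((Polynomial.X : Polynomial ℝ) ^ d k) • (P k).map Polynomial.C)).roots.toFinset.filter
          (fun t => 0 < t)).card ≤ 2 * Fintype.card ι + 1 := by
  set p := Matrix.det (((Polynomial.X : Polynomial ℝ) ^ e) • J.map Polynomial.C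
        + ∑ k, ((Polynomial.X : Polynomial ℝ) ^ d k) • (P k).map Polynomial.C) with hp
  have hsplit : p.roots.toFinset.filter (fun t => 0 < t)
      ⊆ p.roots.toFinset.filter (fun t => 0 < t ∧ t < x₀) ∪ p.roots.toFinset.filter (fun t => x₀ < t)
        ∪ {x₀} := by
    intro t ht
    rw [Finset.mem_filter] at ht
    rw [Finset.mem_union, Finset.mem_union, Finset.mem_filter, Finset.mem_filter, Finset.mem_singleton]
    rcases lt_trichotomy t x₀ with h | h | h
    · exact Or.inl (Or.inl ⟨ht.1, ht.2, h⟩)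
    · exact Or.inr h
    · exact Or.inl (Or.inr ⟨ht.1, h⟩)
  calc (p.roots.toFinset.filter (fun t => 0 < t)).card
      ≤ (p.roots.toFinset.filter (fun t => 0 < t ∧ t < x₀) ∪ p.roots.toFinset.filter (fun t => x₀ < t)
          ∪ {x₀}).card := Finset.card_le_card hsplit
    _ ≤ (p.roots.toFinset.filter (fun t => 0 < t ∧ t < x₀) ∪ p.roots.toFinset.filter (fun t => x₀ < t)).card
          + ({x₀} : Finset ℝ).card := Finset.card_union_le _ _
    _ ≤ (p.roots.toFinset.filter (fun t => 0 < t ∧ t < x₀)).card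
          + (p.roots.toFinset.filter (fun t => x₀ < t)).card + 1 := by
        rw [Finset.card_singleton]
        exact Nat.add_le_add_right (Finset.card_union_le _ _) 1
    _ ≤ Fintype.card ι + Fintype.card ι + 1 :=
        Nat.add_le_add_right (Nat.add_le_add (semidefMoment_posRoots_below_le ι κ e d J P hJ hP hx₀ hle)
          (semidefMoment_posRoots_above_le ι κ e d J P hJ hP hx₀ hle)) 1
    _ = 2 * Fintype.card ι + 1 := by ring

end Law

end Summit.ValiantsHypothesis.ValiantsHypothesis.Theorems.LacunarySymmetroidMatrixDescartes
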